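import Summits.NavierStokesRegularity.NavierStokesRegularity.Theorems.TypeICertificateLadderTargetRotatingConjugateDensityHardy
import Literature.Analysis.FluidPDE.PineauVicolWeightPositivity
import HarnessLib

/-!
# The Kato-type energy bound for the twisted weight equation (tools for the rotating conjugate
# density, stub B2 of line `killing-twisted-bernoulli-solitons`, crux `Target`, stmt-NavierStokesRegularity-1217)

Helper file (all results proved, no definitions, no named facts). Rotating-gauge version of the
first half of step `F5` (sign of the smooth solution) of the tree's `PineauVicolWeightPositivity`
(Pineau–Vicol 2026, Prop. 5.1, arXiv:2607.09619) for `N v = Δ(γv) + div(γv X₀)`, drift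
`X₀ = ½y + U′`, `U′ = U − J` (`DriftHyp U C₀`, `J` skew linear: `div U′ = 0`, `⟪U′y, y⟫ = ⟪Uy, y⟫`,
`U′` UNBOUNDED), and a smooth solution `v` of `N v = 0` with `v, ∇v ∈ L²(γ)`, `γ|y|²v² ∈ L¹`:
`integral_gaussWeight_mul_deriv2_le_rot` (`∫ γ ψ_δ''(v)|∇v|² ≤ δ (C₀/2) ∫γ`, `ψ_δ(t) = √(t² + δ²)`;
the tree's divergence-theorem argument, the unbounded part `γ ψ_δ(v) J y` of the field being
integrable by `|y| γ (|v| + δ) ≤ ½γ(|y|²v² + 1) + ½δγ(|y|² + 1)` — this is where Hardy's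
inequality on `V` enters), `abs_integral_absApprox_transpose_le_rot`
(`|∫ γ ψ_δ(v)(Δφ − Dφ[X₀])| ≤ M δ C₀ ∫γ`), `integral_gaussWeight_mul_abs_transpose_eq_zero_rot`
(`γ|v|` solves the equation distributionally, `δ → 0`).

References: B. Pineau, V. Vicol, arXiv:2607.09619 (2026), Prop. 5.1, Lemma 5.5;
T. Kato, Israel J. Math. 13 (1972) (Kato's inequality).
-/

noncomputable section

open MeasureTheory TopologicalSpace Set Function Filter Topology InnerProductSpace Real
open scoped RealInnerProductSpace ENNReal NNReal ContDiff Distributions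

namespace Summit.NavierStokesRegularity.NavierStokesRegularity.Theorems

open Literature.Analysis.FluidPDE Literature.Analysis.FluidPDE.PineauVicol2026
open scoped Laplacian

variable {E : Type} [NormedAddCommGroup E] [InnerProductSpace ℝ E] [FiniteDimensional ℝ E]
  [MeasurableSpace E] [BorelSpace E]

variable {U : E → E} {C₀ : ℝ}

omit [MeasurableSpace E] [BorelSpace E] in
/-- `div (U − J) = 0` for a divergence-free `U` and a skew linear `J`. [folklore] -/
theorem divergence_sub_skew_eq_zero (h : DriftHyp U C₀) {J : E →L[ℝ] E} (hJ : ∀ v, ⟪J v, v⟫ = 0) (y : E) :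
    VectorCalculus.divergence (fun z => U z - J z) y = 0 := by
  have hUd : DifferentiableAt ℝ U y := h.contDiff_one.differentiable one_ne_zero y
  have hJd : DifferentiableAt ℝ (J : E → E) y := J.differentiableAt
  have e : VectorCalculus.divergence (fun z => U z - J z) y =
      VectorCalculus.divergence U y - VectorCalculus.divergence (J : E → E) y := by
    simp only [VectorCalculus.divergence, fderiv_fun_sub hUd hJd, ContinuousLinearMap.toLinearMap_sub, map_sub]
  rw [e, h.div_eq_zero y, divergence_eq_zero_of_skew hJ, sub_zero]

omit [FiniteDimensional ℝ E] [MeasurableSpace E] [BorelSpace E] in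
/-- `⟪(U − J) y, y⟫ = ⟪U y, y⟫` for skew `J`. [folklore] -/
theorem inner_sub_skew_eq (U : E → E) {J : E →L[ℝ] E} (hJ : ∀ v, ⟪J v, v⟫ = 0) (y : E) :
    ⟪U y - J y, y⟫ = ⟪U y, y⟫ := by
  rw [inner_sub_left, hJ y, sub_zero]

omit [FiniteDimensional ℝ E] [MeasurableSpace E] [BorelSpace E] in
/-- `|(U − J) y| ≤ C₀ + ‖J‖ |y|`. [folklore] -/
theorem norm_sub_skew_le (h : DriftHyp U C₀) (J : E →L[ℝ] E) (y : E) :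
    ‖U y - J y‖ ≤ C₀ + ‖J‖ * ‖y‖ :=
  (norm_sub_le _ _).trans (add_le_add (h.norm_le y) (J.le_opNorm y))

omit [InnerProductSpace ℝ E] [FiniteDimensional ℝ E] [MeasurableSpace E] [BorelSpace E] in
/-- The weighted Young bound `|y| (|v| + δ) ≤ ½(|y|² v² + 1) + ½ δ (|y|² + 1)` (`δ ≥ 0`). [folklore] -/
theorem norm_mul_abs_add_le (y : E) (t : ℝ) {δ : ℝ} (hδ : 0 ≤ δ) :
    ‖y‖ * (|t| + δ) ≤ (1 / 2 : ℝ) * (‖y‖ ^ 2 * t ^ 2 + 1) + (1 / 2 : ℝ) * δ * (‖y‖ ^ 2 + 1) := by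
  have h1 : ‖y‖ * |t| ≤ (1 / 2 : ℝ) * (‖y‖ ^ 2 * t ^ 2 + 1) := by nlinarith [sq_nonneg (‖y‖ * |t| - 1), sq_abs t]
  have h2 : ‖y‖ * δ ≤ (1 / 2 : ℝ) * δ * (‖y‖ ^ 2 + 1) := by nlinarith [sq_nonneg (‖y‖ - 1), norm_nonneg y]
  nlinarith

/-- **The energy bound, rotating gauge.** For a smooth solution `v` of `N v = 0`,
`N = Δ(γ·) + div(γ · (½y + U − J))`, with `v, ∇v ∈ L²(γ)`, `γ|y|²v²` integrable and every
`δ > 0`: `∫ γ ψ_δ''(v) |∇v|² ≤ δ · (C₀/2) ∫ γ`. [folklore] -/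
theorem integral_gaussWeight_mul_deriv2_le_rot (h : DriftHyp U C₀) {J : E →L[ℝ] E} (hJ : ∀ v, ⟪J v, v⟫ = 0)
    {v : E → ℝ} (hv : ContDiff ℝ ∞ v)
    (hv2 : MemLp v 2 (gaussMeasure (E := E))) (hG2 : MemLp (gradient v) 2 (gaussMeasure (E := E)))
    (hH : Integrable (fun y => gaussWeight y * (‖y‖ ^ 2 * v y ^ 2)))
    (hN : ∀ y, adjN (fun z : E => (1 / 2 : ℝ) • z + (U z - J z)) v y = 0) {δ : ℝ} (hδ : 0 < δ) :
    ∫ y, gaussWeight y * (δ ^ 2 / absApprox δ (v y) ^ 3) * ‖gradient v y‖ ^ 2 ≤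
      δ * (C₀ / 2 * ∫ y : E, gaussWeight y) := by
  haveI : CompleteSpace E := FiniteDimensional.complete ℝ E
  set U' : E → E := fun z => U z - J z with hU'
  have hU's : ContDiff ℝ ∞ U' := h.contDiff.sub J.contDiff
  have hU'1 : ContDiff ℝ 1 U' := hU's.of_le (mod_cast le_top)
  have hU'c : Continuous U' := hU's.continuous
  set X₀ : E → E := fun z => (1 / 2 : ℝ) • z + U' z with hX₀
  have hX₀1 : ContDiff ℝ 1 X₀ := ((contDiff_id.const_smul (1 / 2 : ℝ)).add hU's).of_le (mod_cast le_top)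
  set ψ : ℝ → ℝ := absApprox δ with hψdef
  have hψ : ContDiff ℝ 2 ψ := contDiff_absApprox hδ
  have hψs : ContDiff ℝ ∞ ψ := contDiff_absApprox hδ
  have hψd : Differentiable ℝ ψ := hψ.differentiable (by norm_num)
  have hv2c : ContDiff ℝ 2 v := hv.of_le (by norm_cast)
  have hvd : Differentiable ℝ v := (hv.of_le (by norm_cast)).differentiable one_ne_zero
  have hC₀ := h.nonneg
  have hdivU' : ∀ y, VectorCalculus.divergence U' y = 0 := divergence_sub_skew_eq_zero h hJ
  have hinU' : ∀ y, ⟪U' y, y⟫ = ⟪U y, y⟫ := inner_sub_skew_eq U hJ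
  -- the field and its divergence
  set F : E → E := fun z => gradient (fun w => gaussWeight w * (ψ ∘ v) w) z + (gaussWeight z * (ψ ∘ v) z) • X₀ z
    with hFdef
  have hFeq : ∀ y, F y = gaussWeight y • (deriv ψ (v y) • gradient v y + ψ (v y) • U' y) := fun y =>
    gradient_add_smul_eq hψd hvd y
  have hγψv : ContDiff ℝ ∞ (fun w => gaussWeight w * (ψ ∘ v) w) := contDiff_gaussWeight.mul (hψs.comp hv)
  have hF1 : ContDiff ℝ 1 F :=
    (PineauVicol2026.contDiff_gradient (n := 1) (hγψv.of_le (by norm_cast))).add ((hγψv.of_le (by norm_cast)).smul hX₀1)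
  have hdivF : ∀ y, VectorCalculus.divergence F y =
      (ψ (v y) - v y * (v y / ψ (v y))) * (gaussWeight y * (VectorCalculus.divergence U' y - ⟪U' y, y⟫ / 2)) +
        gaussWeight y * (δ ^ 2 / ψ (v y) ^ 3) * ‖gradient v y‖ ^ 2 := by
    intro y
    rw [hFdef, ← adjN_eq_divergence (hψ.comp hv2c) hX₀1, adjN_comp_eq hψ hv2c hX₀1, hN y, mul_zero, zero_add,
      adjN_one_eq hU'1, hψdef, deriv_deriv_absApprox hδ, deriv_absApprox hδ]
  -- integrability of `F` (the unbounded part of the drift is paid for by Hardy)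
  have hγv : Integrable (fun y => gaussWeight y * v y) := integrable_gaussWeight_mul_of_memLp hv2
  have hγG : Integrable (fun y => gaussWeight y • gradient v y) := integrable_gaussWeight_smul_of_memLp hG2
  have hγy : Integrable (fun y : E => ‖y‖ ^ 2 * gaussWeight y) := integrable_norm_sq_mul_gaussWeight
  have hFi : Integrable F := by
    refine Integrable.mono' (g := fun y => ‖gaussWeight y • gradient v y‖ + C₀ * ‖gaussWeight y * v y‖ +
        δ * C₀ * gaussWeight y + ‖J‖ * ((1 / 2 : ℝ) * (gaussWeight y * (‖y‖ ^ 2 * v y ^ 2) + gaussWeight y) +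
          (1 / 2 : ℝ) * δ * (‖y‖ ^ 2 * gaussWeight y + gaussWeight y)))
      (((hγG.norm.add (hγv.norm.const_mul C₀)).add (integrable_gaussWeight.const_mul _)).add
        ((((hH.add integrable_gaussWeight).const_mul _).add ((hγy.add integrable_gaussWeight).const_mul _)).const_mul _))
      hF1.continuous.aestronglyMeasurable (Eventually.of_forall fun y => ?_)
    rw [hFeq y]
    have hγ := (gaussWeight_pos y).le
    have h1 : ‖deriv ψ (v y) • gradient v y‖ ≤ ‖gradient v y‖ := by
      rw [norm_smul, hψdef, deriv_absApprox hδ, Real.norm_eq_abs]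
      exact mul_le_of_le_one_left (norm_nonneg _) (abs_deriv_absApprox_le hδ _)
    have h2 : ‖ψ (v y) • U' y‖ ≤ (|v y| + δ) * (C₀ + ‖J‖ * ‖y‖) := by
      rw [norm_smul, Real.norm_eq_abs, abs_of_pos (absApprox_pos hδ _)]
      exact mul_le_mul (absApprox_le hδ _) (norm_sub_skew_le h J y) (norm_nonneg _) (by positivity)
    have h3 := norm_mul_abs_add_le y (v y) hδ.le
    have hJ0 : 0 ≤ ‖J‖ := norm_nonneg _
    have h4 : (|v y| + δ) * (C₀ + ‖J‖ * ‖y‖) ≤ (|v y| + δ) * C₀ +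
        ‖J‖ * ((1 / 2 : ℝ) * (‖y‖ ^ 2 * v y ^ 2 + 1) + (1 / 2 : ℝ) * δ * (‖y‖ ^ 2 + 1)) := by
      have := mul_le_mul_of_nonneg_left h3 hJ0
      nlinarith [this]
    calc ‖gaussWeight y • (deriv ψ (v y) • gradient v y + ψ (v y) • U' y)‖
        = gaussWeight y * ‖deriv ψ (v y) • gradient v y + ψ (v y) • U' y‖ := by
          rw [norm_smul, Real.norm_of_nonneg hγ]
      _ ≤ gaussWeight y * (‖gradient v y‖ + ((|v y| + δ) * C₀ +
          ‖J‖ * ((1 / 2 : ℝ) * (‖y‖ ^ 2 * v y ^ 2 + 1) + (1 / 2 : ℝ) * δ * (‖y‖ ^ 2 + 1)))) :=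
          mul_le_mul_of_nonneg_left ((norm_add_le _ _).trans (add_le_add h1 (h2.trans h4))) hγ
      _ = ‖gaussWeight y • gradient v y‖ + C₀ * ‖gaussWeight y * v y‖ + δ * C₀ * gaussWeight y +
          ‖J‖ * ((1 / 2 : ℝ) * (gaussWeight y * (‖y‖ ^ 2 * v y ^ 2) + gaussWeight y) +
            (1 / 2 : ℝ) * δ * (‖y‖ ^ 2 * gaussWeight y + gaussWeight y)) := by
          rw [norm_smul, Real.norm_of_nonneg hγ, norm_mul, Real.norm_of_nonneg hγ, Real.norm_eq_abs]
          ring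
  -- integrability of `div F`
  have hN1 : ∀ y, gaussWeight y * (VectorCalculus.divergence U' y - ⟪U' y, y⟫ / 2) = -(gaussWeight y * (⟪U y, y⟫ / 2)) := by
    intro y; rw [hdivU' y, hinU' y]; ring
  have hA : Integrable (fun y => (ψ (v y) - v y * (v y / ψ (v y))) *
      (gaussWeight y * (VectorCalculus.divergence U' y - ⟪U' y, y⟫ / 2))) := by
    refine Integrable.mono' (g := fun y => δ * (C₀ / 2 * gaussWeight y)) ((integrable_gaussWeight.const_mul _).const_mul _) ?_ (Eventually.of_forall fun y => ?_)
    · exact (((hψ.continuous.comp hv.continuous).sub (hv.continuous.mul (hv.continuous.div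
        (hψ.continuous.comp hv.continuous) fun y => (absApprox_pos hδ _).ne'))).mul
        (continuous_gaussWeight.mul ((continuous_divergence (hU'1.continuous_fderiv one_ne_zero)).sub
          ((hU'c.inner continuous_id).div_const 2)))).aestronglyMeasurable
    · rw [hN1, norm_mul, norm_neg, norm_mul, Real.norm_of_nonneg (gaussWeight_pos y).le, Real.norm_eq_abs,
        Real.norm_eq_abs]
      obtain ⟨h0, h1⟩ := absApprox_sub_mul_deriv_mem hδ (v y)
      rw [abs_of_nonneg h0]
      have hin : |⟪U y, y⟫ / 2| ≤ C₀ / 2 := by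
        rw [abs_div, abs_two]; exact div_le_div_of_nonneg_right (h.abs_inner_le y) (by norm_num)
      have := mul_le_mul h1 (mul_le_mul_of_nonneg_left hin (gaussWeight_pos y).le)
        (mul_nonneg (gaussWeight_pos y).le (abs_nonneg _)) hδ.le
      calc _ ≤ δ * (gaussWeight y * (C₀ / 2)) := this
        _ = δ * (C₀ / 2 * gaussWeight y) := by ring
  have hB : Integrable (fun y => gaussWeight y * (δ ^ 2 / ψ (v y) ^ 3) * ‖gradient v y‖ ^ 2) := by
    refine Integrable.mono' (g := fun y => (1 / δ) * (gaussWeight y * ‖gradient v y‖ ^ 2))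
      ((integrable_gaussWeight_mul_norm_sq_of_memLp hG2).const_mul _) ?_ (Eventually.of_forall fun y => ?_)
    · exact ((continuous_gaussWeight.mul ((continuous_const.div ((hψ.continuous.comp hv.continuous).pow 3)
        fun y => pow_ne_zero 3 (absApprox_pos hδ _).ne'))).mul
        ((continuous_gradient_of_contDiff (hv.of_le (by norm_cast))).norm.pow 2)).aestronglyMeasurable
    · have hγ := (gaussWeight_pos y).le
      have hnn : 0 ≤ gaussWeight y * (δ ^ 2 / ψ (v y) ^ 3) * ‖gradient v y‖ ^ 2 :=
        mul_nonneg (mul_nonneg hγ (deriv2_absApprox_nonneg hδ _)) (sq_nonneg _)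
      rw [Real.norm_of_nonneg hnn]
      have := deriv2_absApprox_le hδ (v y)
      have h3 : gaussWeight y * (δ ^ 2 / ψ (v y) ^ 3) ≤ gaussWeight y * (1 / δ) := mul_le_mul_of_nonneg_left this hγ
      calc _ ≤ gaussWeight y * (1 / δ) * ‖gradient v y‖ ^ 2 := mul_le_mul_of_nonneg_right h3 (sq_nonneg _)
        _ = (1 / δ) * (gaussWeight y * ‖gradient v y‖ ^ 2) := by ring
  have hdivi : Integrable (fun y => VectorCalculus.divergence F y) := by
    refine (hA.add hB).congr (Eventually.of_forall fun y => ?_)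
    simp only [Pi.add_apply]
    exact (hdivF y).symm
  -- the vanishing integral
  have h0 := integral_divergence_eq_zero_of_integrable hF1 hFi hdivi
  have hsplit : ∫ y, VectorCalculus.divergence F y =
      (∫ y, (ψ (v y) - v y * (v y / ψ (v y))) * (gaussWeight y * (VectorCalculus.divergence U' y - ⟪U' y, y⟫ / 2))) +
        ∫ y, gaussWeight y * (δ ^ 2 / ψ (v y) ^ 3) * ‖gradient v y‖ ^ 2 := by
    rw [← integral_add hA hB]
    exact integral_congr_ae (Eventually.of_forall hdivF)
  rw [hsplit] at h0
  -- bound the first integral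
  have hAle : |∫ y, (ψ (v y) - v y * (v y / ψ (v y))) *
      (gaussWeight y * (VectorCalculus.divergence U' y - ⟪U' y, y⟫ / 2))| ≤ δ * (C₀ / 2 * ∫ y : E, gaussWeight y) := by
    rw [← integral_const_mul, ← integral_const_mul, ← Real.norm_eq_abs]
    refine (norm_integral_le_integral_norm _).trans (integral_mono_of_nonneg (Eventually.of_forall fun y => norm_nonneg _)
      ((integrable_gaussWeight.const_mul _).const_mul _) (Eventually.of_forall fun y => ?_))
    dsimp only
    rw [hN1, norm_mul, norm_neg, norm_mul, Real.norm_of_nonneg (gaussWeight_pos y).le, Real.norm_eq_abs, Real.norm_eq_abs]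
    obtain ⟨h0', h1⟩ := absApprox_sub_mul_deriv_mem hδ (v y)
    rw [abs_of_nonneg h0']
    have hin : |⟪U y, y⟫ / 2| ≤ C₀ / 2 := by
      rw [abs_div, abs_two]; exact div_le_div_of_nonneg_right (h.abs_inner_le y) (by norm_num)
    have := mul_le_mul h1 (mul_le_mul_of_nonneg_left hin (gaussWeight_pos y).le)
      (mul_nonneg (gaussWeight_pos y).le (abs_nonneg _)) hδ.le
    calc _ ≤ δ * (gaussWeight y * (C₀ / 2)) := this
      _ = δ * (C₀ / 2 * gaussWeight y) := by ring
  have := neg_le_abs (∫ y, (ψ (v y) - v y * (v y / ψ (v y))) * (gaussWeight y * (VectorCalculus.divergence U' y - ⟪U' y, y⟫ / 2)))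
  linarith

/-- **Test-function bound, rotating gauge.** With the same data, for a test function `φ` with
`|φ| ≤ M`: `|∫ γ ψ_δ(v) (Δφ − Dφ[½y + U − J])| ≤ M · δ C₀ ∫γ`. [folklore] -/
theorem abs_integral_absApprox_transpose_le_rot (h : DriftHyp U C₀) {J : E →L[ℝ] E} (hJ : ∀ v, ⟪J v, v⟫ = 0)
    {v : E → ℝ} (hv : ContDiff ℝ ∞ v)
    (hv2 : MemLp v 2 (gaussMeasure (E := E))) (hG2 : MemLp (gradient v) 2 (gaussMeasure (E := E)))
    (hH : Integrable (fun y => gaussWeight y * (‖y‖ ^ 2 * v y ^ 2)))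
    (hN : ∀ y, adjN (fun z : E => (1 / 2 : ℝ) • z + (U z - J z)) v y = 0) {δ : ℝ} (hδ : 0 < δ)
    {φ : E → ℝ} (hφ : ContDiff ℝ ∞ φ) (hφc : HasCompactSupport φ) {M : ℝ} (hM : ∀ y, |φ y| ≤ M) :
    |∫ y, gaussWeight y * absApprox δ (v y) * ((Δ φ) y - fderiv ℝ φ y ((1 / 2 : ℝ) • y + (U y - J y)))| ≤
      M * (2 * (δ * (C₀ / 2 * ∫ y : E, gaussWeight y))) := by
  set U' : E → E := fun z => U z - J z with hU'
  have hU's : ContDiff ℝ ∞ U' := h.contDiff.sub J.contDiff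
  have hU'1 : ContDiff ℝ 1 U' := hU's.of_le (mod_cast le_top)
  have hU'c : Continuous U' := hU's.continuous
  set X₀ : E → E := fun z => (1 / 2 : ℝ) • z + U' z with hX₀
  have hX₀1 : ContDiff ℝ 1 X₀ := ((contDiff_id.const_smul (1 / 2 : ℝ)).add hU's).of_le (mod_cast le_top)
  have hψ : ContDiff ℝ 2 (absApprox δ) := contDiff_absApprox hδ
  have hv2c : ContDiff ℝ 2 v := hv.of_le (by norm_cast)
  have hM0 : 0 ≤ M := (abs_nonneg _).trans (hM 0)
  have hC₀ := h.nonneg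
  have hdivU' : ∀ y, VectorCalculus.divergence U' y = 0 := divergence_sub_skew_eq_zero h hJ
  have hinU' : ∀ y, ⟪U' y, y⟫ = ⟪U y, y⟫ := inner_sub_skew_eq U hJ
  have hw2 : ContDiff ℝ 2 (fun z => gaussWeight z * (absApprox δ ∘ v) z) := contDiff_gaussWeight.mul (hψ.comp hv2c)
  -- transpose onto `N(ψ ∘ v)`
  have ht := integral_mul_transpose_eq (X₀ := X₀) hw2 hX₀1 hφ hφc
  have hid : ∀ y, (Δ (fun z => gaussWeight z * (absApprox δ ∘ v) z)) y +
      VectorCalculus.divergence (fun z => (gaussWeight z * (absApprox δ ∘ v) z) • X₀ z) y =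
      (absApprox δ (v y) - v y * (v y / absApprox δ (v y))) *
        (gaussWeight y * (VectorCalculus.divergence U' y - ⟪U' y, y⟫ / 2)) +
        gaussWeight y * (δ ^ 2 / absApprox δ (v y) ^ 3) * ‖gradient v y‖ ^ 2 := by
    intro y
    have e := adjN_comp_eq (X₀ := X₀) hψ hv2c hX₀1 y
    rwa [hN y, mul_zero, zero_add, adjN_one_eq hU'1, deriv_deriv_absApprox hδ, deriv_absApprox hδ] at e
  have heq : ∫ y, gaussWeight y * absApprox δ (v y) * ((Δ φ) y - fderiv ℝ φ y (X₀ y)) =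
      ∫ y, ((absApprox δ (v y) - v y * (v y / absApprox δ (v y))) *
        (gaussWeight y * (VectorCalculus.divergence U' y - ⟪U' y, y⟫ / 2)) * φ y +
        gaussWeight y * (δ ^ 2 / absApprox δ (v y) ^ 3) * ‖gradient v y‖ ^ 2 * φ y) := by
    have e0 : ∫ y, gaussWeight y * absApprox δ (v y) * ((Δ φ) y - fderiv ℝ φ y (X₀ y)) =
        ∫ y, (gaussWeight y * (absApprox δ ∘ v) y) * ((Δ φ) y - fderiv ℝ φ y (X₀ y)) :=
      integral_congr_ae (Eventually.of_forall fun y => rfl)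
    rw [e0, ht]
    refine integral_congr_ae (Eventually.of_forall fun y => ?_)
    dsimp only
    rw [hid y]
    ring
  -- the two bounds
  have hN1 : ∀ y, gaussWeight y * (VectorCalculus.divergence U' y - ⟪U' y, y⟫ / 2) = -(gaussWeight y * (⟪U y, y⟫ / 2)) := by
    intro y; rw [hdivU' y, hinU' y]; ring
  have hptA : ∀ y, ‖(absApprox δ (v y) - v y * (v y / absApprox δ (v y))) *
      (gaussWeight y * (VectorCalculus.divergence U' y - ⟪U' y, y⟫ / 2)) * φ y‖ ≤ M * (δ * (C₀ / 2 * gaussWeight y)) := by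
    intro y
    rw [hN1, norm_mul, norm_mul, norm_neg, norm_mul, Real.norm_of_nonneg (gaussWeight_pos y).le, Real.norm_eq_abs,
      Real.norm_eq_abs, Real.norm_eq_abs]
    obtain ⟨h0', h1⟩ := absApprox_sub_mul_deriv_mem hδ (v y)
    rw [abs_of_nonneg h0']
    have hin : |⟪U y, y⟫ / 2| ≤ C₀ / 2 := by
      rw [abs_div, abs_two]; exact div_le_div_of_nonneg_right (h.abs_inner_le y) (by norm_num)
    have h2 := mul_le_mul h1 (mul_le_mul_of_nonneg_left hin (gaussWeight_pos y).le)
      (mul_nonneg (gaussWeight_pos y).le (abs_nonneg _)) hδ.le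
    have h3 := mul_le_mul h2 (hM y) (abs_nonneg _)
      (mul_nonneg hδ.le (mul_nonneg (gaussWeight_pos y).le (by positivity)))
    calc _ ≤ δ * (gaussWeight y * (C₀ / 2)) * M := h3
      _ = M * (δ * (C₀ / 2 * gaussWeight y)) := by ring
  have hptB : ∀ y, ‖gaussWeight y * (δ ^ 2 / absApprox δ (v y) ^ 3) * ‖gradient v y‖ ^ 2 * φ y‖ ≤
      M * (gaussWeight y * (δ ^ 2 / absApprox δ (v y) ^ 3) * ‖gradient v y‖ ^ 2) := by
    intro y
    have hnn : 0 ≤ gaussWeight y * (δ ^ 2 / absApprox δ (v y) ^ 3) * ‖gradient v y‖ ^ 2 :=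
      mul_nonneg (mul_nonneg (gaussWeight_pos y).le (deriv2_absApprox_nonneg hδ _)) (sq_nonneg _)
    rw [norm_mul, Real.norm_of_nonneg hnn, Real.norm_eq_abs, mul_comm]
    exact mul_le_mul_of_nonneg_right (hM y) hnn
  -- integrability
  have hcontA0 : Continuous fun y => (absApprox δ (v y) - v y * (v y / absApprox δ (v y))) *
      (gaussWeight y * (VectorCalculus.divergence U' y - ⟪U' y, y⟫ / 2)) :=
    (((hψ.continuous.comp hv.continuous).sub (hv.continuous.mul (hv.continuous.div
        (hψ.continuous.comp hv.continuous) fun y => (absApprox_pos hδ _).ne'))).mul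
        (continuous_gaussWeight.mul ((continuous_divergence (hU'1.continuous_fderiv one_ne_zero)).sub
          ((hU'c.inner continuous_id).div_const 2))))
  have hcontA : Continuous fun y => (absApprox δ (v y) - v y * (v y / absApprox δ (v y))) *
      (gaussWeight y * (VectorCalculus.divergence U' y - ⟪U' y, y⟫ / 2)) * φ y := hcontA0.mul hφ.continuous
  have hcontB0 : Continuous fun y => gaussWeight y * (δ ^ 2 / absApprox δ (v y) ^ 3) * ‖gradient v y‖ ^ 2 :=
    (continuous_gaussWeight.mul ((continuous_const.div ((hψ.continuous.comp hv.continuous).pow 3)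
        fun y => pow_ne_zero 3 (absApprox_pos hδ _).ne'))).mul
        ((continuous_gradient_of_contDiff (hv.of_le (by norm_cast))).norm.pow 2)
  have hcontB : Continuous fun y => gaussWeight y * (δ ^ 2 / absApprox δ (v y) ^ 3) * ‖gradient v y‖ ^ 2 * φ y :=
    hcontB0.mul hφ.continuous
  have hiA : Integrable (fun y => (absApprox δ (v y) - v y * (v y / absApprox δ (v y))) *
      (gaussWeight y * (VectorCalculus.divergence U' y - ⟪U' y, y⟫ / 2)) * φ y) :=
    Integrable.mono' (((integrable_gaussWeight.const_mul _).const_mul _).const_mul _) hcontA.aestronglyMeasurable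
      (Eventually.of_forall hptA)
  have hB0 : Integrable (fun y => gaussWeight y * (δ ^ 2 / absApprox δ (v y) ^ 3) * ‖gradient v y‖ ^ 2) := by
    refine Integrable.mono' (g := fun y => (1 / δ) * (gaussWeight y * ‖gradient v y‖ ^ 2))
      ((integrable_gaussWeight_mul_norm_sq_of_memLp hG2).const_mul _) hcontB0.aestronglyMeasurable
      (Eventually.of_forall fun y => ?_)
    have hγ := (gaussWeight_pos y).le
    have hnn : 0 ≤ gaussWeight y * (δ ^ 2 / absApprox δ (v y) ^ 3) * ‖gradient v y‖ ^ 2 :=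
      mul_nonneg (mul_nonneg hγ (deriv2_absApprox_nonneg hδ _)) (sq_nonneg _)
    rw [Real.norm_of_nonneg hnn]
    have h3 : gaussWeight y * (δ ^ 2 / absApprox δ (v y) ^ 3) ≤ gaussWeight y * (1 / δ) :=
      mul_le_mul_of_nonneg_left (deriv2_absApprox_le hδ (v y)) hγ
    calc _ ≤ gaussWeight y * (1 / δ) * ‖gradient v y‖ ^ 2 := mul_le_mul_of_nonneg_right h3 (sq_nonneg _)
      _ = (1 / δ) * (gaussWeight y * ‖gradient v y‖ ^ 2) := by ring
  have hiB : Integrable (fun y => gaussWeight y * (δ ^ 2 / absApprox δ (v y) ^ 3) * ‖gradient v y‖ ^ 2 * φ y) :=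
    Integrable.mono' (hB0.const_mul M) hcontB.aestronglyMeasurable (Eventually.of_forall hptB)
  have henergy := integral_gaussWeight_mul_deriv2_le_rot h hJ hv hv2 hG2 hH hN hδ
  have hX₀y : ∀ y, (1 / 2 : ℝ) • y + (U y - J y) = X₀ y := fun y => rfl
  simp only [hX₀y]
  rw [heq, integral_add hiA hiB]
  have bA : |∫ y, (absApprox δ (v y) - v y * (v y / absApprox δ (v y))) *
      (gaussWeight y * (VectorCalculus.divergence U' y - ⟪U' y, y⟫ / 2)) * φ y| ≤ M * (δ * (C₀ / 2 * ∫ y : E, gaussWeight y)) := by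
    rw [← integral_const_mul, ← integral_const_mul, ← integral_const_mul, ← Real.norm_eq_abs]
    exact (norm_integral_le_integral_norm _).trans (integral_mono_of_nonneg (Eventually.of_forall fun y => norm_nonneg _)
      (((integrable_gaussWeight.const_mul _).const_mul _).const_mul _) (Eventually.of_forall hptA))
  have bB : |∫ y, gaussWeight y * (δ ^ 2 / absApprox δ (v y) ^ 3) * ‖gradient v y‖ ^ 2 * φ y| ≤
      M * (δ * (C₀ / 2 * ∫ y : E, gaussWeight y)) := by
    have h1 : |∫ y, gaussWeight y * (δ ^ 2 / absApprox δ (v y) ^ 3) * ‖gradient v y‖ ^ 2 * φ y| ≤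
        M * ∫ y, gaussWeight y * (δ ^ 2 / absApprox δ (v y) ^ 3) * ‖gradient v y‖ ^ 2 := by
      rw [← integral_const_mul, ← Real.norm_eq_abs]
      exact (norm_integral_le_integral_norm _).trans (integral_mono_of_nonneg (Eventually.of_forall fun y => norm_nonneg _)
        (hB0.const_mul M) (Eventually.of_forall hptB))
    exact h1.trans (mul_le_mul_of_nonneg_left henergy hM0)
  calc _ ≤ |∫ y, (absApprox δ (v y) - v y * (v y / absApprox δ (v y))) *
        (gaussWeight y * (VectorCalculus.divergence U' y - ⟪U' y, y⟫ / 2)) * φ y| +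
        |∫ y, gaussWeight y * (δ ^ 2 / absApprox δ (v y) ^ 3) * ‖gradient v y‖ ^ 2 * φ y| := abs_add_le _ _
    _ ≤ M * (2 * (δ * (C₀ / 2 * ∫ y : E, gaussWeight y))) := by linarith

/-- **`|v|` solves the twisted equation distributionally**: `∫ γ|v| (Δφ − Dφ[½y + U − J]) = 0` for
every test function (`δ → 0` in the test-function bound; dominated convergence). [folklore] -/
theorem integral_gaussWeight_mul_abs_transpose_eq_zero_rot (h : DriftHyp U C₀) {J : E →L[ℝ] E}
    (hJ : ∀ v, ⟪J v, v⟫ = 0) {v : E → ℝ}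
    (hv : ContDiff ℝ ∞ v) (hv2 : MemLp v 2 (gaussMeasure (E := E))) (hG2 : MemLp (gradient v) 2 (gaussMeasure (E := E)))
    (hH : Integrable (fun y => gaussWeight y * (‖y‖ ^ 2 * v y ^ 2)))
    (hN : ∀ y, adjN (fun z : E => (1 / 2 : ℝ) • z + (U z - J z)) v y = 0)
    {φ : E → ℝ} (hφ : ContDiff ℝ ∞ φ) (hφc : HasCompactSupport φ) :
    ∫ y, gaussWeight y * |v y| * ((Δ φ) y - fderiv ℝ φ y ((1 / 2 : ℝ) • y + (U y - J y))) = 0 := by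
  obtain ⟨M, hM⟩ := exists_bound_of_hasCompactSupport hφ.continuous hφc
  have hM' : ∀ y, |φ y| ≤ M := fun y => by rw [← Real.norm_eq_abs]; exact hM y
  have hU'c : Continuous fun z => U z - J z := h.continuous.sub J.continuous
  -- the multiplier `g = Δφ − Dφ[X₀]` is bounded (continuous, compactly supported)
  set g : E → ℝ := fun y => (Δ φ) y - fderiv ℝ φ y ((1 / 2 : ℝ) • y + (U y - J y)) with hg
  have hφ2 : ContDiff ℝ 2 φ := hφ.of_le (by norm_cast)
  have hgc : Continuous g := (continuous_laplacian hφ2).sub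
    ((hφ.continuous_fderiv (by simp)).clm_apply ((continuous_id.const_smul _).add hU'c))
  have hgs : HasCompactSupport g := by
    refine hasCompactSupport_of_eq_zero hφc fun y hy => ?_
    simp only [hg, laplacian_eq_zero_of_notMem_tsupport hy, fderiv_of_notMem_tsupport ℝ hy, zero_apply, sub_zero]
  obtain ⟨K, hK⟩ := exists_bound_of_hasCompactSupport hgc hgs
  -- the sequence
  set a : ℕ → ℝ := fun n => ∫ y, gaussWeight y * absApprox (1 / ((n : ℝ) + 1)) (v y) * g y with ha
  have h1 : Tendsto a atTop (𝓝 0) := by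
    have hb : ∀ n : ℕ, |a n| ≤ M * (2 * ((1 / ((n : ℝ) + 1)) * (C₀ / 2 * ∫ y : E, gaussWeight y))) := fun n =>
      abs_integral_absApprox_transpose_le_rot h hJ hv hv2 hG2 hH hN (by positivity) hφ hφc hM'
    have hlim : Tendsto (fun n : ℕ => M * (2 * ((1 / ((n : ℝ) + 1)) * (C₀ / 2 * ∫ y : E, gaussWeight y)))) atTop (𝓝 0) := by
      simpa using ((tendsto_one_div_add_atTop_nhds_zero_nat.mul_const (C₀ / 2 * ∫ y : E, gaussWeight y)).const_mul 2).const_mul M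
    exact squeeze_zero_norm (fun n => by rw [Real.norm_eq_abs]; exact hb n) hlim
  have hγv : Integrable (fun y => gaussWeight y * v y) := integrable_gaussWeight_mul_of_memLp hv2
  have h2 : Tendsto a atTop (𝓝 (∫ y, gaussWeight y * |v y| * g y)) := by
    refine tendsto_integral_of_dominated_convergence (fun y => (‖gaussWeight y * v y‖ + gaussWeight y) * K)
      (fun n => ?_) ((hγv.norm.add integrable_gaussWeight).mul_const K) (fun n => Eventually.of_forall fun y => ?_)
      (Eventually.of_forall fun y => ?_)
    · exact ((continuous_gaussWeight.mul ((contDiff_absApprox (n := 0) (by positivity)).continuous.comp hv.continuous)).mul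
        hgc).aestronglyMeasurable
    · have hn : (0 : ℝ) < 1 / ((n : ℝ) + 1) := by positivity
      rw [norm_mul, norm_mul, Real.norm_of_nonneg (gaussWeight_pos y).le, Real.norm_eq_abs,
        abs_of_pos (absApprox_pos hn _), norm_mul, Real.norm_of_nonneg (gaussWeight_pos y).le, Real.norm_eq_abs]
      have hle := absApprox_le hn (v y)
      have hle1 : (1 : ℝ) / ((n : ℝ) + 1) ≤ 1 := by
        rw [div_le_one (by positivity)]; linarith [n.cast_nonneg (α := ℝ)]
      have hγ := (gaussWeight_pos y).le
      calc gaussWeight y * absApprox (1 / ((n : ℝ) + 1)) (v y) * ‖g y‖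
          ≤ gaussWeight y * (|v y| + 1) * K := by
            refine mul_le_mul (mul_le_mul_of_nonneg_left (hle.trans (by linarith)) hγ) (hK y) (norm_nonneg _) ?_
            positivity
        _ = (gaussWeight y * |v y| + gaussWeight y) * K := by ring
    · exact ((tendsto_absApprox (v y)).const_mul (gaussWeight y)).mul_const (g y)
  exact tendsto_nhds_unique h2 h1

/-- **Registered form (B2 tool stub `rotatingDensity_katoAbs`, `ℝ³`, `J = α • rotGenL`):** for a smooth
finite-energy solution `v` of `N v = 0` (drift `½y + U − α rotGen`), `γ|v|` is again a
distributional solution (Kato). [cite: PineauVicol2026, Prop. 5.1 / Lemma 5.5] -/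
theorem rotatingDensity_katoAbs :
    ∀ (U : EuclideanSpace ℝ (Fin 3) → EuclideanSpace ℝ (Fin 3)) (C₀ α : ℝ), Literature.Analysis.FluidPDE.PineauVicol2026.DriftHyp U C₀ → ∀ v : EuclideanSpace ℝ (Fin 3) → ℝ, ContDiff ℝ (⊤ : ℕ∞) v → MeasureTheory.MemLp v 2 (Literature.Analysis.FluidPDE.PineauVicol2026.gaussMeasure (E := EuclideanSpace ℝ (Fin 3))) → MeasureTheory.MemLp (gradient v) 2 (Literature.Analysis.FluidPDE.PineauVicol2026.gaussMeasure (E := EuclideanSpace ℝ (Fin 3))) → MeasureTheory.Integrable (fun y => Literature.Analysis.FluidPDE.PineauVicol2026.gaussWeight y * (‖y‖ ^ 2 * v y ^ 2)) → (∀ y : EuclideanSpace ℝ (Fin 3), Literature.Analysis.FluidPDE.PineauVicol2026.adjN (fun z => (1 / 2 : ℝ) • z + (U z - α • Literature.Analysis.FluidPDE.rotGen z)) v y = 0) → ∀ φ : EuclideanSpace ℝ (Fin 3) → ℝ, ContDiff ℝ (⊤ : ℕ∞) φ → HasCompactSupport φ → ∫ y, Literature.Analysis.FluidPDE.PineauVicol2026.gaussWeight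 y * |v y| * (Laplacian.laplacian φ y - fderiv ℝ φ y ((1 / 2 : ℝ) • y + (U y - α • Literature.Analysis.FluidPDE.rotGen y))) = 0 := by
  intro U C₀ α h v hv hv2 hG2 hH hN φ hφ hφc
  have hJ : ∀ w : EuclideanSpace ℝ (Fin 3), ⟪(α • rotGenL) w, w⟫ = 0 := fun w => by
    rw [_root_.FunLike.coe_smul, Pi.smul_apply, rotGenL_apply, real_inner_smul_left, inner_rotGen_self, mul_zero]
  exact integral_gaussWeight_mul_abs_transpose_eq_zero_rot h hJ hv hv2 hG2 hH hN hφ hφc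

end Summit.NavierStokesRegularity.NavierStokesRegularity.Theorems
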